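import Literature.AlgebraicGeometry.Frobenioids.PadicKummerRemark242Thm24i
import Literature.AlgebraicGeometry.Frobenioids.PadicKummerDualityIsoLocalField
import HarnessLib

/-!
# Frobenioids II, Remark 2.4.2 at an `(N, H)`-SATURATED object of the arithmetic context: with the
# CUP-PRODUCT duality isomorphism and a natural `F_N(A) ⥲ ℤ/Nℤ`, Theorem 2.4 (i) holds and (ii) fails

Proof-only closing corollary (abc-iut cell, layer L1, seat abc-iut-w5-d248 gen 2; SUBDAG-FrdII-Thm24
row L26) of `PadicKummerRemark242Thm24i.lean` (p420104), instantiating the two remaining DATA of the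
Remark 2.4.2 statement by the tree's CONSTRUCTED objects at abc-iut-L1-t7's arithmetic context
`Def22Context.ofLocalField L H hH O^×_L`: the duality isomorphism
`H¹(H_A, μ_N(A)) ⥲ H_A^ab ⊗ F_N(A)` "induced by the cup product" (abc-iut-L2-t12's
`Def22Context.dualityIsoOfLocalField`, no residual input) and an isomorphism `F_N(A) ⥲ ℤ/Nℤ`
(abc-iut-L1-t7's `nonempty_fn_equiv_zmod_ofLocalField`), both available exactly under print's standing
hypothesis "`A` is `(N, H)`-saturated" (Def. 2.2 (ii)).

S. Mochizuki, *The geometry of Frobenioids II*, Kyushu J. Math. **62** (2008), Thm. 2.4 pp. 19–20 and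
Rmk. 2.4.2 p. 22 [cite: MochizukiFrdII2008, Rmk 2.4.2 p.22]: "if the `Φᵢ` are not fieldwise saturated,
then the natural isomorphisms `F_N(Aᵢ) ⥲ ℤ/Nℤ` are not, in general, compatible with the isomorphism
`F_N(A₁) ⥲ F_N(A₂)` induced by `Ψ` … the unit-wise Frobenius functor … acts on `F_N(Aᵢ)` … by raising
to the `ζ`-th power [cf. "the compatibility with the reciprocity map" asserted in Theorem 2.4, (i)]".

* `Def22Context.rmk242_vs_thm24_ofLocalField_saturated` — `K` non-archimedean local of characteristic
  `0`, `L ⊆ K̄` finite Galois, `H ⊆ G_K` open normal, `N > 2`, `A` `(N, H)`-saturated with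
  `O^□(A) = O^×_L`: there are an isomorphism `inv : F_N(A) ⥲ ℤ/Nℤ` and an automorphism `e` of the
  Definition 2.2 data (identity on `Aut_E(A_E)`) whose comparison data satisfy `Thm24i` with the
  CUP-PRODUCT duality isomorphism on both sides (every `p`, `fs`) and `Thm24iActionCompat`, yet are
  `InvariantIncompatible` for `inv` (indeed for every `inv`), so `Thm24ii … True True …` fails.

No new definitions; nothing here concerns [IUTchIII]; the category→context binding of the unit-wise
Frobenius functor ([FrdI] Prop. 2.9 (ii)) remains abc-iut-L1-t7's (α) item.
-/

namespace Literature.AlgebraicGeometry.Frobenioids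

namespace PadicKummer

namespace Def22Context

open Kummer Field
open Literature.AnabelianGeometry.AbsoluteAnabelian (unitSubmonoid)

variable {K : Type} [Field K] [ValuativeRel K] [TopologicalSpace K] [IsNonarchimedeanLocalField K]
  [CharZero K] (L : IntermediateField K (AlgebraicClosure K)) [Normal K L] [FiniteDimensional K L]
  (H : Subgroup (absoluteGaloisGroup K)) [H.Normal] (hH : IsOpen (H : Set (absoluteGaloisGroup K)))
  (N : ℕ) [NeZero N]

omit [TopologicalSpace K] [IsNonarchimedeanLocalField K] [CharZero K] [Normal K L]
  [FiniteDimensional K L] in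
/-- The `N`-th roots of unity of `L` lie in `O^×_L` (abc-iut-L1-t7's `mem_unitsStableSubmonoid_of_pow_eq_one`,
in the shape of the `hS` input of the duality constructors). [cite: MochizukiFrdII2008, Def 2.2 (iii) p.18] -/
theorem unitsStableSubmonoid_mem_of_pow_eq_one :
    ∀ x : L, x ^ N = 1 → x ∈ (unitsStableSubmonoid K L).toSubmonoid :=
  fun _ hx => mem_unitsStableSubmonoid_of_pow_eq_one K L N (NeZero.pos N) hx

/-- **Remark 2.4.2 versus Theorem 2.4 at an `(N, H)`-saturated object of the arithmetic context with
`O^□ = O^×_L`** (FrdII pp. 19–22): for `N > 2` there are an isomorphism `inv : F_N(A) ⥲ ℤ/Nℤ` and an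
automorphism `e` of the Definition 2.2 data, the identity on `Aut_E(A_E)` (an `ℓ`-th power on `O^×_L`),
such that the induced comparison data satisfy Theorem 2.4 (i) — with the CUP-PRODUCT duality
isomorphism `dualityIsoOfLocalField` on both sides, for every `p`, `fs` — and its action clause, but
are `InvariantIncompatible` for EVERY `F_N(A) ⥲ ℤ/Nℤ` (in particular for `inv`): the conclusion of
Theorem 2.4 (ii) fails for them. [cite: MochizukiFrdII2008, Rmk 2.4.2 p.22] -/
theorem rmk242_vs_thm24_ofLocalField_saturated (hN : 2 < N)
    (h : IsNHSaturated (ofLocalField L H hH (unitsStableSubmonoid K L)) N) :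
    ∃ (inv : FNInvariant (ofLocalField L H hH (unitsStableSubmonoid K L)) N)
      (e : Def22Context.Iso (ofLocalField L H hH (unitsStableSubmonoid K L))
        (ofLocalField L H hH (unitsStableSubmonoid K L))),
      (∀ τ, e.isoE τ = τ) ∧
      (∀ (p : ℕ) (fs : Prop), Thm24i _ _ N p p fs fs (e.thm24Data N)
        (dualityIsoOfLocalField L H hH (unitsStableSubmonoid K L) N
          (unitsStableSubmonoid_mem_of_pow_eq_one L N) h)
        (dualityIsoOfLocalField L H hH (unitsStableSubmonoid K L) N
          (unitsStableSubmonoid_mem_of_pow_eq_one L N) h)) ∧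
      Thm24iActionCompat _ _ N (e.thm24Data N) ∧
      (∀ inv' : FNInvariant (ofLocalField L H hH (unitsStableSubmonoid K L)) N,
        InvariantIncompatible _ _ N (e.thm24Data N) inv' inv') ∧
      ¬ Thm24ii _ _ N True True (e.thm24Data N) inv inv := by
  obtain ⟨f⟩ := nonempty_fn_equiv_zmod_ofLocalField L H hH (unitsStableSubmonoid K L) N
    (unitsStableSubmonoid_mem_of_pow_eq_one L N)
    (rootsOfUnity_mem_of_isNHSaturated L H hH (unitsStableSubmonoid K L) N h) h
  obtain ⟨e, hE, hi, hact, hinc⟩ :=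
    rmk242_witness_thm24i_and_incompatible_ofLocalField L H hH N hN
  exact ⟨⟨f⟩, e, hE, fun p fs => hi p fs _, hact, fun inv' => (hinc inv').1, (hinc ⟨f⟩).2⟩

end Def22Context

end PadicKummer

end Literature.AlgebraicGeometry.Frobenioids
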